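import Summits.PneNP.PneNP.Theorems.PermanentDescentCollapseMakesPermanentEasyIslandDecode
import Summits.PneNP.PneNP.Theorems.PermanentDescentCollapseMakesPermanentEasyIslandRecords
import Summits.PneNP.PneNP.Theorems.PermanentDescentCollapseMakesPermanentEasyIslandHitting
import Summits.PneNP.PneNP.Theorems.PermanentDescentCollapseMakesPermanentEasyIslandInterp
import Summits.PneNP.PneNP.Theorems.PermanentDescentCollapseMakesPermanentEasyIslandPrimes
import Summits.PneNP.PneNP.Theorems.PermanentDescentCollapseMakesPermanentEasyIslandLineFP
import Summits.PneNP.PneNP.Theorems.PermanentDescentCollapseMakesPermanentEasyIslandValFP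
import Literature.Computability.Complexity.CodeFPFinite
import HarnessLib

/-!
# Route PermanentDescent, crux `CollapseMakesPermanentEasy` (stmt-PneNP-16142), line `Sketch`
# (idea `errorless-islands`): THE BRIDGE — a polynomial-time sound dense island puts `PermBits` in `P/poly`

`islandBridge : ∀ T, T ∈ P → SoundIsland T → DenseIsland T → PermBits ∈ P/poly`, UNCONDITIONAL
(Lipton 1991's random self-reduction of the permanent in ERASURE form, made NON-UNIFORM: neither a collapse
nor `BPP ⊆ Σ₂` is used), and the registered seam `stub_bridge` of the skeleton
`Cruxes/CollapseMakesPermanentEasy/Lines/Sketch.lean` (the same with the five leaf statements as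
hypotheses), discharged from the LANDED leaf stubs `stub_hitting` (p166338), `stub_interp` (p165711),
`stub_primes` (p165514), `stub_lineFP` (p165698), `stub_valFP` (p165904).

Proof. `P/poly = P + poly advice`; the advice for side `n` is a RECORD (part B): for the finitely many
`n < max n₀ 256` (`n₀` the density threshold) an exhaustive value table; for larger `n` the random
self-reduction record `(∏ S, [], [(p, [0..p-1], [1..p-1], crtT S p 1, dirs_p) | p ∈ S])` over the set `S`
of ALL primes in `(n³, 8n³]` (product `≥ 4^{n³} ≥ 2^{n²+1} > perm`, Stub N), where `dirs_p` are the
hitting directions of Stub H for the certified slice `S_p = {M | T certifies perm M}` (density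
`≥ 4(n+1)/p` by `DenseIsland`). Its value at a word `s` of side `n` is `permWord n s`
(`exists_goodRec_large`): each decoded residue is `perm mod p` (part A `resFor_eq`: soundness makes
certified points true, Stub I interpolates, Stub H guarantees a success) and the idempotents recombine
them (part B `crt_recombine`); its code has length `≤ 23·(8n³)^22`. The decider `decideX` is polynomial
time by Stubs LF/VF, and part B `permBits_mem_PPoly_of_goodRecs` concludes.

Sources: R. J. Lipton, DIMACS Ser. 2 (1991), §3; D. Beaver, J. Feigenbaum, STACS 1990; S. Arora,
B. Barak, *Computational Complexity* (2009), §8.6.2, Thm. 6.18.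
-/

set_option linter.dupNamespace false -- `Summit.PneNP.PneNP.…`: summit = sub-problem name (D-0017 single-conjunct layout)

namespace Summit.PneNP.PneNP.Theorems.PermIsland

open _root_.Computability Polynomial
open Literature.Computability.Complexity Literature.Computability.Complexity.Brick
  Literature.Computability.Complexity.CodeFP Literature.Computability.Complexity.ModArith
open Summit.PneNP.PneNP.Theorems.PermCert

/-! #### The record of a large side -/

section LargeSide

variable {T : Language Bool} {χ : List Bool → Bool} (hχ : ∀ w, χ w = true ↔ w ∈ T) (hS : SoundIsland T)
variable (hI1 : ∀ (p n : ℕ) (M D : Matrix (Fin n) (Fin n) (ZMod p)),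
    ∃ f : Polynomial (ZMod p), f.natDegree ≤ n ∧ ∀ c : ZMod p, f.eval c = (M + c • D).permanent)
variable (hI2 : ∀ (p : ℕ) [Fact p.Prime] (f : Polynomial (ZMod p)) (pts : List (ℕ × ℕ)),
    f.natDegree < pts.length → (pts.map Prod.fst).Nodup →
    (∀ q ∈ pts, q.1 < p ∧ (q.2 : ZMod p) = f.eval (q.1 : ZMod p)) →
    (lagrAt0 p pts : ZMod p) = f.eval 0)

include hχ hS hI1 hI2 in
/-- **Good records for large sides (the random self-reduction record).** Given a set `S` of primes in
`(n³, 8n³]` with product `≥ 2^{n²+1}` and, for each of them, hitting directions for the island's slice, the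
record `(∏ S, [], [(p, [0..p-1], [1..p-1], crtT S p 1, dirs_p) | p ∈ S])` is good for side `n` and has
code length `≤ 23·(8n³)^22`. [cite: Lipton1991, §3] [cite: AroraBarakCC2009, §8.6.2] -/
theorem exists_goodRec_large {n : ℕ} (hn : 2 ≤ n) (S : Finset ℕ) (hSsub : S ⊆ Finset.Ioc (n ^ 3) (8 * n ^ 3))
    (hSp : ∀ p ∈ S, p.Prime) (hprod : 2 ^ (n * n + 1) ≤ SmallPrimes.crtM S)
    (hhit : ∀ p ∈ S, ∀ [Fact p.Prime], ∃ Sp : Finset (Matrix (Fin n) (Fin n) (ZMod p)),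
      (∀ M, M ∈ Sp → encIsland p n (resOfMat M) (M.permanent).val ∈ T) ∧
      ∃ dirs : List (Matrix (Fin n) (Fin n) (ZMod p)), dirs.length ≤ p ^ 2 * n ^ 2 ∧
        ∀ M, ∃ D ∈ dirs, n + 1 ≤ (Finset.univ.filter fun c : ZMod p => c ≠ 0 ∧ M + c • D ∈ Sp).card) :
    ∃ r : SRec, GoodRec χ n r ∧ (srE r).length ≤ 23 * (8 * n ^ 3) ^ 22 := by
  classical
  -- the per-prime data, at the level of residue lists
  have hdat : ∀ p : ℕ, ∃ dirs : List (List ℕ), p ∈ S →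
      dirs.length ≤ p ^ 2 * n ^ 2 ∧ (∀ d ∈ dirs, d.length = n * n ∧ ∀ x ∈ d, x < p) ∧
      ∀ s : List Bool, s.length = n * n → ∀ e : ℕ,
        resFor χ n (p, List.range p, (List.range (p - 1)).map (· + 1), e, dirs) (resOfWord s) = permWord n s % p := by
    intro p
    by_cases hp : p ∈ S
    · haveI : Fact p.Prime := ⟨hSp p hp⟩
      obtain ⟨Sp, hSpT, dirs, hlen, hdirs⟩ := hhit p hp
      refine ⟨dirs.map resOfMat, fun _ => ⟨by simpa using hlen, fun d hd => ?_, fun s hs e => ?_⟩⟩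
      · obtain ⟨D, _, rfl⟩ := List.mem_map.1 hd
        refine ⟨by simp [resOfMat], fun x hx => ?_⟩
        obtain ⟨i, rfl⟩ := List.mem_ofFn.1 hx
        exact ZMod.val_lt _
      · exact resFor_eq hχ hS hI1 hI2 hs e Sp hSpT dirs hdirs
    · exact ⟨[], fun h => absurd h hp⟩
  choose dirsOf hdirsOf using hdat
  -- the record
  set N := SmallPrimes.crtM S with hN
  set ps : List ℕ := S.sort (· ≤ ·) with hps
  set mk : ℕ → PRec := fun p =>
    (p, List.range p, (List.range (p - 1)).map (· + 1), SmallPrimes.crtT S p 1, dirsOf p) with hmk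
  have hpsS : ps.toFinset = S := Finset.sort_toFinset _ _
  have hpsnd : ps.Nodup := Finset.sort_nodup _ _
  have hmemps : ∀ p, p ∈ ps ↔ p ∈ S := fun p => Finset.mem_sort _
  refine ⟨(N, [], ps.map mk), fun s hs => ?_, ?_⟩
  · -- goodness
    have hE : permWord n s < N := (permWord_lt_two_pow_aux n s).trans_le hprod
    show (tabVal [] s).getD (crtVal χ n (N, [], ps.map mk) (resOfWord s)) = permWord n s
    rw [show tabVal [] s = none from rfl, Option.getD_none]
    show sumM N ((ps.map mk).map fun P => mulM N (resFor χ n P (resOfWord s)) P.2.2.2.1) = permWord n s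
    rw [List.map_map]
    exact crt_recombine S hSp hE ps hpsnd hpsS (fun p => resFor χ n (mk p) (resOfWord s))
      fun p hp => (hdirsOf p hp).2.2 s hs _
  · -- length
    set K := 8 * n ^ 3 with hK
    have hn3 : 8 ≤ n ^ 3 := by
      calc (8 : ℕ) = 2 ^ 3 := by norm_num
        _ ≤ n ^ 3 := Nat.pow_le_pow_left hn 3
    have hK64 : 64 ≤ K := by omega
    have hK1 : 1 ≤ K := by omega
    set U := K ^ 11 with hU
    have hKU : K ≤ U := by
      calc K = K ^ 1 := (pow_one K).symm
        _ ≤ K ^ 11 := Nat.pow_le_pow_right hK1 (by norm_num)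
    have hU7 : K ^ 7 ≤ U := Nat.pow_le_pow_right hK1 (by norm_num)
    have hU64 : 64 ≤ U := hK64.trans hKU
    -- sizes of the players
    have hpK : ∀ p ∈ S, p ≤ K := fun p hp => (Finset.mem_Ioc.1 (hSsub hp)).2
    have hcard : S.card ≤ K := by
      calc S.card ≤ (Finset.Ioc (n ^ 3) (8 * n ^ 3)).card := Finset.card_le_card hSsub
        _ = 8 * n ^ 3 - n ^ 3 := Nat.card_Ioc _ _
        _ ≤ K := by omega
    have h2K : K < 2 ^ K := Nat.lt_two_pow_self
    have h2KK : 2 ^ K ≤ 2 ^ (K * K) := Nat.pow_le_pow_right (by norm_num) (Nat.le_mul_self K)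
    have hNlt : N < 2 ^ (K * K) := by
      calc N ≤ K ^ S.card := Finset.prod_le_pow_card S (fun p => p) K hpK
        _ ≤ K ^ K := Nat.pow_le_pow_right hK1 hcard
        _ < (2 ^ K) ^ K := Nat.pow_lt_pow_left h2K (by omega)
        _ = 2 ^ (K * K) := by rw [← pow_mul]
    have hlenN : (natE N).length ≤ U := (length_natE_le_pow hK1 hNlt).trans hU7
    -- the prime records
    have hP : ∀ p ∈ S, (prE (mk p)).length ≤ 10 * U := by
      intro p hp
      have hp' := hpK p hp
      have hplt : p < 2 ^ (K * K) := (lt_of_le_of_lt hp' h2K).trans_le h2KK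
      obtain ⟨hdl, hdwf, -⟩ := hdirsOf p hp
      have a1 : (natE p).length ≤ U := (length_natE_le_pow hK1 hplt).trans hU7
      have a2 : (rawE natE (List.range p)).length ≤ U :=
        (length_rawE_natE_le_pow (by omega) (by rw [List.length_range]; exact hp')
          fun x hx => (List.mem_range.1 hx).trans hplt).trans hU7
      have a3 : (rawE natE ((List.range (p - 1)).map (· + 1))).length ≤ U :=
        (length_rawE_natE_le_pow (by omega) (by rw [List.length_map, List.length_range]; omega)
          fun x hx => by
            obtain ⟨j, hj, rfl⟩ := List.mem_map.1 hx
            have := List.mem_range.1 hj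
            exact lt_of_lt_of_le (by omega) (le_of_lt hplt)).trans hU7
      have a4 : (natE (SmallPrimes.crtT S p 1)).length ≤ U :=
        (length_natE_le_pow hK1 ((SmallPrimes.crtT_lt S hSp p 1).trans hNlt)).trans hU7
      have a5 : (rawE (rawE natE) (dirsOf p)).length ≤ U := by
        have hnnK : n * n ≤ K := by nlinarith
        have b1 : ∀ d ∈ dirsOf p, (rawE natE d).length ≤ K ^ 7 := fun d hd =>
          length_rawE_natE_le_pow (by omega) (by rw [(hdwf d hd).1]; exact hnnK)
            fun x hx => ((hdwf d hd).2 x hx).trans hplt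
        have b2 := length_rawE_le_of_forall b1
        have b3 : (dirsOf p).length ≤ K ^ 3 := by
          calc (dirsOf p).length ≤ p ^ 2 * n ^ 2 := hdl
            _ ≤ K ^ 2 * K := Nat.mul_le_mul (Nat.pow_le_pow_left hp' 2) (by nlinarith)
            _ = K ^ 3 := by ring
        calc (rawE (rawE natE) (dirsOf p)).length ≤ (dirsOf p).length * (2 * K ^ 7 + 2) := b2
          _ ≤ K ^ 3 * (2 * K ^ 7 + 2) := Nat.mul_le_mul_right _ b3
          _ ≤ K ^ 3 * (3 * K ^ 7) := Nat.mul_le_mul_left _ (by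
              have hK7 : K ≤ K ^ 7 := by
                calc K = K ^ 1 := (pow_one K).symm
                  _ ≤ K ^ 7 := Nat.pow_le_pow_right hK1 (by norm_num)
              omega)
          _ = 3 * K ^ 10 := by ring
          _ ≤ K * K ^ 10 := Nat.mul_le_mul_right _ (by omega)
          _ = U := by rw [hU]; ring
      rw [hmk]
      simp only [prE, length_pairE_mk]
      omega
    have hprs : (rawE prE (ps.map mk)).length ≤ U * (2 * (10 * U) + 2) := by
      have b := length_rawE_le_of_forall (e := prE) (l := ps.map mk) (B := 10 * U) fun P hPm => by
        obtain ⟨p, hp, rfl⟩ := List.mem_map.1 hPm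
        exact hP p ((hmemps p).1 hp)
      have hlen : (ps.map mk).length ≤ U := by
        rw [List.length_map, hps, Finset.length_sort]
        exact hcard.trans hKU
      exact b.trans (Nat.mul_le_mul_right _ hlen)
    have hfin : 2 * U + 2 + (2 * 0 + 2 + U * (2 * (10 * U) + 2)) ≤ 23 * U ^ 2 := by nlinarith [hU64]
    have hsr : (srE (N, ([] : List (List Bool × ℕ)), ps.map mk)).length =
        2 * (natE N).length + 2 + (2 * (rawE (pairE strE natE) ([] : List (List Bool × ℕ))).length + 2 +
          (rawE prE (ps.map mk)).length) := by
      simp only [srE, length_pairE_mk]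
    rw [hsr, rawE_nil, List.length_nil]
    calc 2 * (natE N).length + 2 + (2 * 0 + 2 + (rawE prE (ps.map mk)).length)
        ≤ 2 * U + 2 + (2 * 0 + 2 + U * (2 * (10 * U) + 2)) := by omega
      _ ≤ 23 * U ^ 2 := hfin
      _ = 23 * (8 * n ^ 3) ^ 22 := by rw [hU, hK, ← pow_mul]

end LargeSide


/-! ### §4 The bridge -/

/-- **THE BRIDGE from the leaf statements** (hitting directions, interpolation, prime supply, the two
machine-level statements — the registered stubs of line `Sketch`, taken as hypotheses): a polynomial-time
sound dense island puts `PermBits` in `P/poly`. Small sides get table records, large sides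
(`n ≥ max n₀ 256`) the random self-reduction record over all primes in `(n³, 8n³]`.
[cite: Lipton1991, §3] [cite: AroraBarakCC2009, §8.6.2, Thm. 6.18] -/
theorem islandBridge_of_stubs
    (hH : ∀ (p n : ℕ) [Fact p.Prime] (S : Finset (Matrix (Fin n) (Fin n) (ZMod p))),
      2 ≤ n → n ^ 3 < p → 4 * (n + 1) * p ^ (n * n) ≤ p * S.card →
      ∃ dirs : List (Matrix (Fin n) (Fin n) (ZMod p)), dirs.length ≤ p ^ 2 * n ^ 2 ∧
        ∀ M : Matrix (Fin n) (Fin n) (ZMod p), ∃ D ∈ dirs,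
          n + 1 ≤ (Finset.univ.filter fun c : ZMod p => c ≠ 0 ∧ M + c • D ∈ S).card)
    (hI : (∀ (p n : ℕ) (M D : Matrix (Fin n) (Fin n) (ZMod p)),
      ∃ f : Polynomial (ZMod p), f.natDegree ≤ n ∧ ∀ c : ZMod p, f.eval c = (M + c • D).permanent) ∧
    (∀ (p : ℕ) [Fact p.Prime] (f : Polynomial (ZMod p)) (pts : List (ℕ × ℕ)),
      f.natDegree < pts.length → (pts.map Prod.fst).Nodup →
      (∀ q ∈ pts, q.1 < p ∧ (q.2 : ZMod p) = f.eval (q.1 : ZMod p)) →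
      (lagrAt0 p pts : ZMod p) = f.eval 0))
    (hN : ∀ n : ℕ, 256 ≤ n → 4 ^ (n ^ 3) ≤ ∏ p ∈ (Finset.Ioc (n ^ 3) (8 * n ^ 3)).filter Nat.Prime, p)
    (hLF : ∀ χ : List Bool → Bool, CodeFP strE bitE χ →
      CodeFP (pairE (pairE natE natE) (pairE (pairE (rawE natE) (rawE natE)) (pairE (rawE natE) (rawE natE))))
        (optE natE) (fun t => lineTry χ t.1.1 t.1.2 t.2.1.1 t.2.1.2 t.2.2.1 t.2.2.2))
    (hVF : ∀ χ : List Bool → Bool, CodeFP strE bitE χ →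
      CodeFP (pairE (pairE natE natE) (pairE (pairE (rawE natE) (rawE natE)) (pairE (rawE natE) (rawE natE))))
        (optE natE) (fun t => lineTry χ t.1.1 t.1.2 t.2.1.1 t.2.1.2 t.2.2.1 t.2.2.2) →
      CodeFP (pairE strE (rawE srE)) bitE (fun t => decideX χ t.2 t.1)) :
    ∀ T : Language Bool, T ∈ Classes.P → SoundIsland T → DenseIsland T → PermBits ∈ PPoly := by
  intro T hT hS hD
  classical
  obtain ⟨n₀, hdense⟩ := hD
  -- the island predicate
  set χ : List Bool → Bool := fun w => T.boolIndicator w with hχdef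
  have hχC : CodeFP strE bitE χ := of_fn _ (indicatorFn_mem_FP hT) fun _ => rfl
  have hχ : ∀ w, χ w = true ↔ w ∈ T := fun w => (Set.mem_iff_boolIndicator T w).symm
  have hdec := hVF χ hχC (hLF χ hχC)
  -- small sides: tables
  have htab := fun n => exists_goodRec_table χ n
  choose R₀ hR₀ using htab
  set N₁ := max n₀ 256 with hN₁
  set B₀ := ((List.range N₁).map fun n => (srE (R₀ n)).length).sum with hB₀
  -- the polynomial bound
  refine permBits_mem_PPoly_of_goodRecs χ hdec ⟨C B₀ + C 23 * (C 8 * X ^ 3) ^ 22, fun n => ?_⟩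
  have heval : (C B₀ + C 23 * (C 8 * X ^ 3) ^ 22 : Polynomial ℕ).eval n = B₀ + 23 * (8 * n ^ 3) ^ 22 := by
    simp [eval_add, eval_mul, eval_pow, eval_X]
  rw [heval]
  by_cases hn : n < N₁
  · refine ⟨R₀ n, hR₀ n, le_trans ?_ (Nat.le_add_right _ _)⟩
    exact List.le_sum_of_mem (List.mem_map.2 ⟨n, List.mem_range.2 hn, rfl⟩)
  · rw [not_lt] at hn
    have hn₀ : n₀ ≤ n := le_trans (le_max_left _ _) hn
    have h256 : 256 ≤ n := le_trans (le_max_right _ _) hn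
    have hn2 : 2 ≤ n := by omega
    set S := (Finset.Ioc (n ^ 3) (8 * n ^ 3)).filter Nat.Prime with hSdef
    have hSsub : S ⊆ Finset.Ioc (n ^ 3) (8 * n ^ 3) := Finset.filter_subset _ _
    have hSp : ∀ p ∈ S, p.Prime := fun p hp => (Finset.mem_filter.1 hp).2
    have hprod : 2 ^ (n * n + 1) ≤ SmallPrimes.crtM S := by
      have h1 := hN n h256
      have h2 : 2 ^ (n * n + 1) ≤ 4 ^ (n ^ 3) := by
        rw [show (4 : ℕ) = 2 ^ 2 by norm_num, ← pow_mul]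
        refine Nat.pow_le_pow_right (by norm_num) ?_
        have : n * n ≤ n ^ 3 := by
          calc n * n = n ^ 2 * 1 := by ring
            _ ≤ n ^ 2 * n := Nat.mul_le_mul_left _ (by omega)
            _ = n ^ 3 := by ring
        have : 1 ≤ n ^ 3 := Nat.one_le_pow _ _ (by omega)
        omega
      exact h2.trans h1
    have hhit : ∀ p ∈ S, ∀ [Fact p.Prime], ∃ Sp : Finset (Matrix (Fin n) (Fin n) (ZMod p)),
        (∀ M, M ∈ Sp → encIsland p n (resOfMat M) (M.permanent).val ∈ T) ∧
        ∃ dirs : List (Matrix (Fin n) (Fin n) (ZMod p)), dirs.length ≤ p ^ 2 * n ^ 2 ∧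
          ∀ M, ∃ D ∈ dirs, n + 1 ≤ (Finset.univ.filter fun c : ZMod p => c ≠ 0 ∧ M + c • D ∈ Sp).card := by
      intro p hp _
      have hpI := Finset.mem_Ioc.1 (hSsub hp)
      set Sp : Finset (Matrix (Fin n) (Fin n) (ZMod p)) :=
        Finset.univ.filter fun M => encIsland p n (resOfMat M) (M.permanent).val ∈ T with hSpdef
      have hSpT : ∀ M, M ∈ Sp → encIsland p n (resOfMat M) (M.permanent).val ∈ T :=
        fun M hM => (Finset.mem_filter.1 hM).2
      have hcardSp : Nat.card {M : Matrix (Fin n) (Fin n) (ZMod p) //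
          encIsland p n (resOfMat M) (M.permanent).val ∈ T} = Sp.card := by
        rw [Nat.card_eq_fintype_card, Fintype.card_subtype]
      have hdens : 4 * (n + 1) * p ^ (n * n) ≤ p * Sp.card := by
        rw [← hcardSp]
        exact hdense n hn₀ p (hSp p hp) hpI.1 hpI.2
      obtain ⟨dirs, hlen, hdirs⟩ := hH p n Sp hn2 hpI.1 hdens
      exact ⟨Sp, hSpT, dirs, hlen, hdirs⟩
    obtain ⟨r, hr, hrlen⟩ := exists_goodRec_large hχ hS hI.1 (fun p _ f pts => hI.2 p f pts) hn2 S hSsub hSp hprod hhit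
    exact ⟨r, hr, hrlen.trans (Nat.le_add_left _ _)⟩


/-- **Stub B of line `Sketch` (THE SEAM), as registered**: from the statements of Stubs H, I, N, LF, VF a
polynomial-time sound dense island puts `PermBits` in `P/poly`. [cite: Lipton1991, §3] [cite: AroraBarakCC2009, §8.6.2, Thm. 6.18] -/
theorem stub_bridge :
    (∀ (p n : ℕ) [Fact p.Prime] (S : Finset (Matrix (Fin n) (Fin n) (ZMod p))),
      2 ≤ n → n ^ 3 < p → 4 * (n + 1) * p ^ (n * n) ≤ p * S.card →
      ∃ dirs : List (Matrix (Fin n) (Fin n) (ZMod p)), dirs.length ≤ p ^ 2 * n ^ 2 ∧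
        ∀ M : Matrix (Fin n) (Fin n) (ZMod p), ∃ D ∈ dirs,
          n + 1 ≤ (Finset.univ.filter fun c : ZMod p => c ≠ 0 ∧ M + c • D ∈ S).card) →
    ((∀ (p n : ℕ) (M D : Matrix (Fin n) (Fin n) (ZMod p)),
      ∃ f : Polynomial (ZMod p), f.natDegree ≤ n ∧ ∀ c : ZMod p, f.eval c = (M + c • D).permanent) ∧
    (∀ (p : ℕ) [Fact p.Prime] (f : Polynomial (ZMod p)) (pts : List (ℕ × ℕ)),
      f.natDegree < pts.length → (pts.map Prod.fst).Nodup →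
      (∀ q ∈ pts, q.1 < p ∧ (q.2 : ZMod p) = f.eval (q.1 : ZMod p)) →
      (lagrAt0 p pts : ZMod p) = f.eval 0)) →
    (∀ n : ℕ, 256 ≤ n → 4 ^ (n ^ 3) ≤ ∏ p ∈ (Finset.Ioc (n ^ 3) (8 * n ^ 3)).filter Nat.Prime, p) →
    (∀ χ : List Bool → Bool, CodeFP strE bitE χ →
      CodeFP (pairE (pairE natE natE) (pairE (pairE (rawE natE) (rawE natE)) (pairE (rawE natE) (rawE natE))))
        (optE natE) (fun t => lineTry χ t.1.1 t.1.2 t.2.1.1 t.2.1.2 t.2.2.1 t.2.2.2)) →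
    (∀ χ : List Bool → Bool, CodeFP strE bitE χ →
      CodeFP (pairE (pairE natE natE) (pairE (pairE (rawE natE) (rawE natE)) (pairE (rawE natE) (rawE natE))))
        (optE natE) (fun t => lineTry χ t.1.1 t.1.2 t.2.1.1 t.2.1.2 t.2.2.1 t.2.2.2) →
      CodeFP (pairE strE (rawE srE)) bitE (fun t => decideX χ t.2 t.1)) →
    ∀ T : Language Bool, T ∈ Classes.P → SoundIsland T → DenseIsland T → PermBits ∈ PPoly :=
  islandBridge_of_stubs

/-- **THE BRIDGE (unconditional).** A polynomial-time SOUND and DENSE island of permanent residues puts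
the bit-graph of the 0/1 permanent in `P/poly`: `T ∈ P → SoundIsland T → DenseIsland T → PermBits ∈ P/poly`
— the registered seam fed with the five landed leaf stubs of line `Sketch`. With the landed uniformization
(`uniformizationUnderCollapse_proof`) the crux `CollapseMakesPermanentEasy` follows from the one open stub
`stub_islandDensity` (`NP ⊆ P → ∃ T ∈ P, SoundIsland T ∧ DenseIsland T`).
[cite: Lipton1991, §3] [cite: AroraBarakCC2009, §8.6.2, Thm. 6.18] -/
theorem islandBridge (T : Language Bool) (hT : T ∈ Classes.P) (hS : SoundIsland T) (hD : DenseIsland T) :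
    PermBits ∈ PPoly :=
  stub_bridge stub_hitting stub_interp stub_primes stub_lineFP stub_valFP T hT hS hD

/-- **The crux from the open stub.** `IslandDensity → CollapseMakesPermanentEasy`: under `NP ⊆ P` a
polynomial-time sound dense island gives `PermBits ∈ P/poly` (the bridge) and the landed uniformization
(`Summit.PneNP.PneNP.Theorems.uniformizationUnderCollapse_proof`, item stmt-PneNP-16145) gives `PermBits ∈ P`.
So the crux `Summit.PneNP.PneNP.Theses.PermanentDescent.CollapseMakesPermanentEasy` is reduced to the single
statement `NP ⊆ P → ∃ T ∈ P, SoundIsland T ∧ DenseIsland T` (Stub D of line `Sketch`, open). [folklore] -/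
theorem collapseMakesPermanentEasy_of_islandDensity
    (hD : Nondeterministic.NP ⊆ Classes.P → ∃ T : Language Bool, T ∈ Classes.P ∧ SoundIsland T ∧ DenseIsland T) :
    Summit.PneNP.PneNP.Theses.PermanentDescent.CollapseMakesPermanentEasy := by
  have u := Summit.PneNP.PneNP.Theorems.uniformizationUnderCollapse_proof
  unfold Summit.PneNP.PneNP.Theses.PermanentDescent.UniformizationUnderCollapse at u
  intro h
  obtain ⟨T, hT, hS, hD'⟩ := hD h
  exact u h (islandBridge T hT hS hD')

end Summit.PneNP.PneNP.Theorems.PermIsland
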